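import Literature.NumberTheory.EllipticCurves.PAdicLFunctionInterpolationHoldsProofs
import Literature.NumberTheory.EllipticCurves.KatoRankBound
import Mathlib.RingTheory.PowerSeries.Order

/-!
# Certified Riemann sums for `ord_{T=0} L_p(E,T)` — truncation bound and certificate criterion

(Filed from crux stmt-BirchSwinnertonDyer-0490, line `Sketch`, lead c4; generic `p`-adic analysis of
the Mazur–Swinnerton-Dyer measure, continuing `PAdicLFunctionInterpolationProofs`.)

The coefficients `c_k = padicLCoeff f α k` of the tree's `p`-adic `L`-function
`L_p(f, α, T) = ∑ c_k T^k` are LIMITS of the Riemann sums `RS(k, n) = padicLRiemannSum f α k n`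
(Mazur–Tate–Teitelbaum 1986, §I.11–I.13). This file turns the tree's Cauchy estimate
`norm_padicLRiemannSum_succ_sub_le` into the **truncation bound**
`‖c_k - RS(k, n)‖ ≤ (C / ‖k!‖_p) · p^{-n}` (`C` any bound for `‖μ_{f,α}‖`) and the resulting
**certificate criterion**: if one Riemann sum is strictly larger than that bound, then
`‖c_k‖ = ‖RS(k, n)‖`, `c_k ≠ 0`, and `ord_{T=0} L_p(f, α, T) ≤ k`. For the newform `f` of an
elliptic curve good ordinary at `p` and `α = unitRoot W p` the two analytic inputs (distribution
relation, boundedness) are unconditional tree theorems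
(`msdMeasure_distribution_of_isNewformOf`, `exists_norm_msdMeasure_le_of_isNewformOf`), so the
criterion needs only an explicit measure bound `C` and the value of ONE Riemann sum
(`order_padicLFunction_le_of_riemannSum_certificate`). This is the statement that the certified
`p = 2` computations attached to the crux item (kit job, lead c4, 2026-08-17) instantiate: a
certified upper bound `ord_T L_2(E,T) ≤ rank E(ℚ)`, curve by curve, is an instance of the line's
open stub NE2⁺ (`stub_padicBSDrank_noExcessTwoPos`) whenever `Ш(E)[2] = 0`.

References: B. Mazur, J. Tate, J. Teitelbaum, Invent. Math. 84 (1986), §I.11–I.13;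
W. Stein, C. Wuthrich, Math. Comp. 82 (2013), §3 (Riemann sums / `p`-adic precision).
-/

namespace Literature.NumberTheory.EllipticCurves

open Filter _root_.Topology
open scoped MatrixGroups ModularForm
open CongruenceSubgroup Literature.NumberTheory.EllipticCurves.ModularForms

section Generic

variable {p : ℕ} [Fact p.Prime] {N : ℕ} {f : CuspForm (Gamma0 N) 2} {α : ℚ_[p]}

/-- **Iterated Cauchy estimate (ultrametric).** If `μ_{f,α}` satisfies the distribution relation
and `‖μ_{f,α}‖ ≤ C`, then `‖RS(k, n + j) - RS(k, n)‖ ≤ (C / ‖k!‖_p) p^{-n}` for every `j`: each step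
`RS(k, i + 1) - RS(k, i)`, `i ≥ n`, is bounded by `(C/‖k!‖) p^{-i} ≤ (C/‖k!‖) p^{-n}`
(`norm_padicLRiemannSum_succ_sub_le`) and `ℚ_p` is ultrametric.
[cite: MazurTateTeitelbaum1986Invent, §I.11–I.13] -/
theorem norm_padicLRiemannSum_add_sub_le
    (hdist : ∀ (n : ℕ) (a : ZMod (p ^ n)),
      ∑ b ∈ Finset.univ.filter (fun b : ZMod (p ^ (n + 1)) ↦
        ZMod.castHom (pow_dvd_pow p n.le_succ) (ZMod (p ^ n)) b = a), msdMeasure f α (n + 1) b =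
        msdMeasure f α n a)
    {C : ℝ} (hC0 : 0 ≤ C) (hC : ∀ (n : ℕ) (a : ZMod (p ^ n)), ‖msdMeasure f α n a‖ ≤ C)
    (k n j : ℕ) :
    ‖padicLRiemannSum f α k (n + j) - padicLRiemannSum f α k n‖ ≤
      C / ‖((k.factorial : ℕ) : ℚ_[p])‖ * (p : ℝ) ^ (-n : ℤ) := by
  have hp1 : (1 : ℝ) ≤ p := by exact_mod_cast (Fact.out : p.Prime).one_lt.le
  have hK : 0 ≤ C / ‖((k.factorial : ℕ) : ℚ_[p])‖ := div_nonneg hC0 (norm_nonneg _)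
  induction j with
  | zero =>
    simp only [Nat.add_zero, sub_self, norm_zero]
    exact mul_nonneg hK (zpow_nonneg (Nat.cast_nonneg _) _)
  | succ j ih =>
    have hstep := norm_padicLRiemannSum_succ_sub_le hdist hC0 hC k (n + j)
    have hmono : (p : ℝ) ^ (-(n + j : ℕ) : ℤ) ≤ (p : ℝ) ^ (-n : ℤ) :=
      zpow_le_zpow_right₀ hp1 (by push_cast; omega)
    have hstep' : ‖padicLRiemannSum f α k (n + j + 1) - padicLRiemannSum f α k (n + j)‖ ≤
        C / ‖((k.factorial : ℕ) : ℚ_[p])‖ * (p : ℝ) ^ (-n : ℤ) :=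
      hstep.trans (mul_le_mul_of_nonneg_left hmono hK)
    have hsplit : padicLRiemannSum f α k (n + (j + 1)) - padicLRiemannSum f α k n =
        (padicLRiemannSum f α k (n + j + 1) - padicLRiemannSum f α k (n + j)) +
          (padicLRiemannSum f α k (n + j) - padicLRiemannSum f α k n) := by
      rw [← add_assoc]; abel
    rw [hsplit]
    exact (IsUltrametricDist.norm_add_le_max _ _).trans (max_le hstep' ih)

/-- **Truncation bound for the coefficients of `L_p(f, α, T)`.** Under the distribution relation
and `‖μ_{f,α}‖ ≤ C`: `‖c_k - RS(k, n)‖ ≤ (C / ‖k!‖_p) · p^{-n}`, where `c_k = padicLCoeff f α k` is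
the limit of the Riemann sums (`tendsto_padicLRiemannSum_of_norm_le`) — the closed ball is closed.
[cite: MazurTateTeitelbaum1986Invent, §I.11–I.13] -/
theorem norm_padicLCoeff_sub_padicLRiemannSum_le
    (hdist : ∀ (n : ℕ) (a : ZMod (p ^ n)),
      ∑ b ∈ Finset.univ.filter (fun b : ZMod (p ^ (n + 1)) ↦
        ZMod.castHom (pow_dvd_pow p n.le_succ) (ZMod (p ^ n)) b = a), msdMeasure f α (n + 1) b =
        msdMeasure f α n a)
    {C : ℝ} (hC0 : 0 ≤ C) (hC : ∀ (n : ℕ) (a : ZMod (p ^ n)), ‖msdMeasure f α n a‖ ≤ C)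
    (k n : ℕ) :
    ‖padicLCoeff f α k - padicLRiemannSum f α k n‖ ≤
      C / ‖((k.factorial : ℕ) : ℚ_[p])‖ * (p : ℝ) ^ (-n : ℤ) := by
  have htend : Tendsto (padicLRiemannSum f α k) atTop (𝓝 (padicLCoeff f α k)) :=
    tendsto_padicLRiemannSum_of_norm_le hdist ⟨C, hC⟩ k
  have hshift : Tendsto (fun j ↦ padicLRiemannSum f α k (n + j)) atTop (𝓝 (padicLCoeff f α k)) := by
    have h := (Filter.tendsto_add_atTop_iff_nat n).mpr htend
    simpa only [add_comm] using h
  have hlim : Tendsto (fun j ↦ ‖padicLRiemannSum f α k (n + j) - padicLRiemannSum f α k n‖) atTop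
      (𝓝 ‖padicLCoeff f α k - padicLRiemannSum f α k n‖) :=
    (hshift.sub tendsto_const_nhds).norm
  exact le_of_tendsto' hlim fun j ↦ norm_padicLRiemannSum_add_sub_le hdist hC0 hC k n j

/-- **Certificate criterion (isosceles).** If one Riemann sum beats the truncation bound,
`(C / ‖k!‖_p) p^{-n} < ‖RS(k, n)‖`, then `‖c_k‖ = ‖RS(k, n)‖` and `c_k ≠ 0`: the error
`c_k - RS(k, n)` is strictly smaller than `RS(k, n)`, and `ℚ_p` is ultrametric.
[cite: MazurTateTeitelbaum1986Invent, §I.11–I.13] -/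
theorem norm_padicLCoeff_eq_of_lt
    (hdist : ∀ (n : ℕ) (a : ZMod (p ^ n)),
      ∑ b ∈ Finset.univ.filter (fun b : ZMod (p ^ (n + 1)) ↦
        ZMod.castHom (pow_dvd_pow p n.le_succ) (ZMod (p ^ n)) b = a), msdMeasure f α (n + 1) b =
        msdMeasure f α n a)
    {C : ℝ} (hC0 : 0 ≤ C) (hC : ∀ (n : ℕ) (a : ZMod (p ^ n)), ‖msdMeasure f α n a‖ ≤ C)
    {k n : ℕ}
    (hlt : C / ‖((k.factorial : ℕ) : ℚ_[p])‖ * (p : ℝ) ^ (-n : ℤ) < ‖padicLRiemannSum f α k n‖) :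
    ‖padicLCoeff f α k‖ = ‖padicLRiemannSum f α k n‖ ∧ padicLCoeff f α k ≠ 0 := by
  have herr : ‖padicLCoeff f α k - padicLRiemannSum f α k n‖ < ‖padicLRiemannSum f α k n‖ :=
    (norm_padicLCoeff_sub_padicLRiemannSum_le hdist hC0 hC k n).trans_lt hlt
  have heq : ‖padicLCoeff f α k‖ = ‖padicLRiemannSum f α k n‖ := by
    have h := IsUltrametricDist.norm_add_eq_max_of_norm_ne_norm herr.ne
    rw [sub_add_cancel, max_eq_right herr.le] at h
    exact h
  refine ⟨heq, fun h0 ↦ ?_⟩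
  have hpos : 0 < ‖padicLRiemannSum f α k n‖ :=
    lt_of_le_of_lt (mul_nonneg (div_nonneg hC0 (norm_nonneg _)) (zpow_nonneg (by positivity) _)) hlt
  rw [h0, norm_zero] at heq
  exact hpos.ne heq

/-- Hence a certified upper bound for the order of vanishing: under the same hypotheses,
`ord_{T=0} L_p(f, α, T) ≤ k` (`PowerSeries.order_le`: the `k`-th coefficient is non-zero).
[cite: MazurTateTeitelbaum1986Invent, §I.11–I.13] -/
theorem order_padicLFunction_le_of_lt
    (hdist : ∀ (n : ℕ) (a : ZMod (p ^ n)),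
      ∑ b ∈ Finset.univ.filter (fun b : ZMod (p ^ (n + 1)) ↦
        ZMod.castHom (pow_dvd_pow p n.le_succ) (ZMod (p ^ n)) b = a), msdMeasure f α (n + 1) b =
        msdMeasure f α n a)
    {C : ℝ} (hC0 : 0 ≤ C) (hC : ∀ (n : ℕ) (a : ZMod (p ^ n)), ‖msdMeasure f α n a‖ ≤ C)
    {k n : ℕ}
    (hlt : C / ‖((k.factorial : ℕ) : ℚ_[p])‖ * (p : ℝ) ^ (-n : ℤ) < ‖padicLRiemannSum f α k n‖) :
    (padicLFunction f α).order ≤ k := by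
  refine PowerSeries.order_le k ?_
  rw [coeff_padicLFunction]
  exact (norm_padicLCoeff_eq_of_lt hdist hC0 hC hlt).2

end Generic

section Elliptic

variable {N : ℕ} [NeZero N] {f : CuspForm (Gamma0 N) 2} {p : ℕ} [Fact p.Prime]
  {W : WeierstrassCurve ℚ} [W.IsGloballyMinimal] [W.IsElliptic]

/-- **Riemann-sum certificate for `ord_{T=0} L_p(E,T)`, unconditional form.** Let `E/ℚ`
(globally minimal `W`) be good ordinary at `p`, `f` the newform of `E`, `α = unitRoot W p`, and
let `C` bound the Mazur–Swinnerton-Dyer measure, `‖μ_{f,α}(a + pⁿℤ_p)‖ ≤ C` for all `n, a` (such a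
`C` exists, `exists_norm_msdMeasure_le_of_isNewformOf`; in practice `C = p^B` with `B` the
`p`-adic denominator bound of the plus symbol over the Manin symbols). If for some level `n` the
Riemann sum `RS(k, n) = padicLRiemannSum f α k n` satisfies `(C / ‖k!‖_p) · p^{-n} < ‖RS(k, n)‖`,
then `ord_{T=0} L_p(E,T) ≤ k`. The distribution relation is the unconditional tree theorem
`msdMeasure_distribution_of_isNewformOf`; nothing else is assumed. With `k = rank E(ℚ)` and
`Ш(E)[p] = 0` (so `corank Sel_{p^∞} = rank`) the conclusion is the instance at `(E, p)` of the
line's stub NE2⁺ / of the `≤` half of the crux. [cite: MazurTateTeitelbaum1986Invent, §I.11–I.13] -/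
theorem order_padicLFunction_le_of_riemannSum_certificate (hord : IsOrdinaryAt W p)
    (hf : IsNewformOf W f) {C : ℝ}
    (hC : ∀ (n : ℕ) (a : ZMod (p ^ n)), ‖msdMeasure f (unitRoot W p : ℚ_[p]) n a‖ ≤ C) {k n : ℕ}
    (hlt : C / ‖((k.factorial : ℕ) : ℚ_[p])‖ * (p : ℝ) ^ (-n : ℤ) <
      ‖padicLRiemannSum f (unitRoot W p : ℚ_[p]) k n‖) :
    (padicLFunction f (unitRoot W p : ℚ_[p])).order ≤ k :=
  order_padicLFunction_le_of_lt (msdMeasure_distribution_of_isNewformOf hord hf)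
    ((norm_nonneg _).trans (hC 0 0)) hC hlt

/-- The same certificate read as the NE2⁺-shaped inequality: if moreover `k ≤ corank Sel_{p^∞}`
(e.g. `k = rank E(ℚ) ≤ corank`, Kummer), then `ord_{T=0} L_p(E,T) ≤ corank_{ℤ_p} Sel_{p^∞}(E/ℚ)`.
[cite: MazurTateTeitelbaum1986Invent, §I.11–I.13] -/
theorem order_padicLFunction_le_selmerCorank_of_riemannSum_certificate (hord : IsOrdinaryAt W p)
    (hf : IsNewformOf W f) {C : ℝ}
    (hC : ∀ (n : ℕ) (a : ZMod (p ^ n)), ‖msdMeasure f (unitRoot W p : ℚ_[p]) n a‖ ≤ C) {k n : ℕ}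
    (hlt : C / ‖((k.factorial : ℕ) : ℚ_[p])‖ * (p : ℝ) ^ (-n : ℤ) <
      ‖padicLRiemannSum f (unitRoot W p : ℚ_[p]) k n‖)
    (hk : k ≤ W.selmerCorank p) :
    (padicLFunction f (unitRoot W p : ℚ_[p])).order ≤ W.selmerCorank p :=
  (order_padicLFunction_le_of_riemannSum_certificate hord hf hC hlt).trans (by exact_mod_cast hk)

end Elliptic

end Literature.NumberTheory.EllipticCurves
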